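import Summits.Ventures.PercRepro.S2CobasisSix
import Summits.Ventures.PercRepro.RankLevelSetCircuitCount
import Mathlib.Combinatorics.Matroid.Minor.Contract

/-!
# PercRepro — S2: THE CONTRACTION LEVER — THE OUTSIDE PART OF A DEPENDENT SET IS DEPENDENT OVER `W` (p7, gen 14; sub-claim S2; for the case `ν = 4` of `(14, 7)`)

In the concentrated case of the nested dichotomy a set `W` of nullity `k` is given; the kit pays the top sets through their circuits. The lever of
this module works in the contraction `N := M ／ W` instead: **`contract_dep_sdiff_of_dep_of_indep_inter`** — if `B` is dependent and `B ∩ W` is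
independent then `B ∖ W` is dependent in `M ／ W` (submodularity `ρ(B ∪ W) + ρ(B ∩ W) ≤ ρ(B) + ρ(W)` against a basis `I` of `W`:
`ρ((B ∖ W) ∪ I) ≤ ρ(B) + ρ(W) − |B ∩ W| < |B ∖ W| + |I|`). So a top `6`-set with three independent points in a nullity-`4` flat `W` of `9` points has its
three outside points DEPENDENT in `N`, a matroid of nullity `3` on `12` points — at most `C(4, 2)·10 + C(5, 3) = 70` such triples
(**`ncard_dep_three_le`**: a dependent `3`-set of a loopless matroid contains a `2`-circuit or is a `3`-circuit; the kit's circuit count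
`Matroid.ncard_circuits_le_choose` on `N`, whose dual rank is **`eRank_dual_contract_add`**: `(M ／ W)✶.eRank + ρ(E) = ρ(W) + |E ∖ W|`)
against the kit's `C(12, 3) = 220`. Axioms: standard.
-/

open scoped Matroid

namespace PercRepro

namespace S2

open Set

variable {α : Type}

/-- **The contraction lever**: if `B` is dependent and `B ∩ W` is independent, then `B ∖ W` is dependent in `M ／ W`. -/
theorem contract_dep_sdiff_of_dep_of_indep_inter (M : Matroid α) [M.Finite] {W B : Set α} (hW : W ⊆ M.E)
    (hB : B ⊆ M.E) (hBdep : M.Dep B) (hind : M.Indep (B ∩ W)) : (M ／ W).Dep (B \ W) := by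
  obtain ⟨I, hI⟩ := M.exists_isBasis W hW
  rw [hI.contract_dep_iff]
  refine ⟨?_, Set.disjoint_sdiff_right⟩
  have hBfin : B.Finite := M.ground_finite.subset hB
  have hIfin : I.Finite := M.ground_finite.subset (hI.subset.trans hW)
  have hUE : (B \ W) ∪ I ⊆ M.E := Set.union_subset (sdiff_subset.trans hB) (hI.subset.trans hW)
  rw [← Matroid.eRk_lt_encard_iff_dep_of_finite (hBfin.sdiff.union hIfin) hUE]
  -- the rank side
  have h1 : M.eRk ((B \ W) ∪ I) ≤ M.eRk (B ∪ W) :=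
    M.eRk_mono (Set.union_subset (sdiff_subset.trans Set.subset_union_left) (hI.subset.trans Set.subset_union_right))
  have h2 := M.eRk_inter_add_eRk_union_le B W
  have h3 : M.eRk (B ∩ W) = (B ∩ W).encard := hind.eRk_eq_encard
  have h4 : I.encard = M.eRk W := hI.encard_eq_eRk
  have h5 : M.eRk B < B.encard := M.eRk_lt_encard_of_dep_of_finite hBfin hBdep
  have h5' : M.eRk B + 1 ≤ B.encard := Order.add_one_le_of_lt h5
  -- the cardinality side
  have hc1 : ((B \ W) ∪ I).encard = (B \ W).encard + I.encard :=
    Set.encard_union_eq (Set.disjoint_left.2 (fun x hx hxI => hx.2 (hI.subset hxI)))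
  have hc2 : (B \ W).encard + (B ∩ W).encard = B.encard := Set.encard_sdiff_add_encard_inter B W
  have hfin : (B ∩ W).encard ≠ ⊤ := (hBfin.inter_of_left W).encard_lt_top.ne
  -- `ρ(U) + 1 + |B ∩ W| ≤ |U| + |B ∩ W|`
  have key : M.eRk ((B \ W) ∪ I) + 1 + (B ∩ W).encard ≤ ((B \ W) ∪ I).encard + (B ∩ W).encard := by
    calc M.eRk ((B \ W) ∪ I) + 1 + (B ∩ W).encard
        ≤ M.eRk (B ∪ W) + 1 + M.eRk (B ∩ W) := by rw [h3]; gcongr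
      _ = (M.eRk (B ∩ W) + M.eRk (B ∪ W)) + 1 := by ring
      _ ≤ (M.eRk B + M.eRk W) + 1 := by gcongr
      _ = (M.eRk B + 1) + I.encard := by rw [h4]; ring
      _ ≤ B.encard + I.encard := by gcongr
      _ = ((B \ W).encard + I.encard) + (B ∩ W).encard := by rw [← hc2]; ring
      _ = ((B \ W) ∪ I).encard + (B ∩ W).encard := by rw [hc1]
  have key' : M.eRk ((B \ W) ∪ I) + 1 ≤ ((B \ W) ∪ I).encard := (ENat.add_le_add_iff_right hfin).1 key
  have hne : M.eRk ((B \ W) ∪ I) ≠ ⊤ :=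
    ((M.eRk_le_encard _).trans_lt (hBfin.sdiff.union hIfin).encard_lt_top).ne
  exact (ENat.add_one_le_iff hne).1 key'

/-- **The dual rank of a contraction**: `(M ／ W)✶.eRank + ρ(E) = ρ(W) + |E ∖ W|` for `W ⊆ E`. -/
theorem eRank_dual_contract_add (M : Matroid α) {W : Set α} (hW : W ⊆ M.E) :
    (M ／ W)✶.eRank + M.eRank = M.eRk W + (M.E \ W).encard := by
  rw [Matroid.dual_contract, Matroid.delete_eq_restrict, Matroid.eRank_restrict, Matroid.dual_ground,
    Matroid.eRk_dual_add_eRank M (M.E \ W) sdiff_subset, Set.sdiff_sdiff_cancel_left hW]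

/-- **The dependent `3`-sets of a loopless finite matroid** `N` with `N✶.eRank = ν`: each contains a `2`-circuit or is a `3`-circuit, so
there are at most `C(ν + 1, 2)·(|E| − 2) + C(ν + 2, 3)` of them. -/
theorem ncard_dep_three_le (N : Matroid α) [N.Finite] {ν : ℕ} (hν : N✶.eRank = (ν : ℕ∞))
    (hL : ∀ e ∈ N.E, ¬ N.IsLoop e) :
    {X : Set α | X ⊆ N.E ∧ X.ncard = 3 ∧ N.Dep X}.ncard ≤
      (ν + 1).choose 2 * (N.E.ncard - 2) + (ν + 2).choose 3 := by
  classical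
  set A : Set (Set α) := ⋃ C ∈ Matroid.circF N 2, {X : Set α | X ⊆ N.E ∧ X.ncard = 3 ∧ C ⊆ X} with hA
  have hcover : {X : Set α | X ⊆ N.E ∧ X.ncard = 3 ∧ N.Dep X} ⊆ A ∪ {C : Set α | N.IsCircuit C ∧ C.ncard = 3} := by
    rintro X ⟨hXE, hX3, hXdep⟩
    have hXfin : X.Finite := N.ground_finite.subset hXE
    obtain ⟨C, hCX, hC⟩ := hXdep.exists_isCircuit_subset
    have hCfin : C.Finite := hXfin.subset hCX
    have hC3 : C.ncard ≤ 3 := by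
      have := Set.ncard_le_ncard hCX hXfin
      omega
    have hC1 : C.ncard ≠ 1 := by
      intro h1
      obtain ⟨e, rfl⟩ := Set.ncard_eq_one.1 h1
      exact hL e (hC.subset_ground (Set.mem_singleton e)) (Matroid.singleton_isCircuit.1 hC)
    have hC0 : C.ncard ≠ 0 := by
      intro h0
      rw [Set.ncard_eq_zero hCfin] at h0
      exact hC.nonempty.ne_empty h0
    rcases (show C.ncard = 2 ∨ C.ncard = 3 by omega) with h | h
    · exact Or.inl (Set.mem_iUnion₂.2 ⟨C, Matroid.mem_circF.2 ⟨hC, h⟩, hXE, hX3, hCX⟩)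
    · have hCeq : C = X := Set.eq_of_subset_of_ncard_le hCX (by omega) hXfin
      exact Or.inr ⟨hCeq ▸ hC, hX3⟩
  have hAfin : A.Finite := N.ground_finite.finite_subsets.subset (fun X hX => by
    obtain ⟨C, -, hX⟩ := Set.mem_iUnion₂.1 hX
    exact hX.1)
  have h3fin : {C : Set α | N.IsCircuit C ∧ C.ncard = 3}.Finite :=
    N.ground_finite.finite_subsets.subset (fun C hC => hC.1.subset_ground)
  -- the union bound over the `2`-circuits
  have hAle : A.ncard ≤ {C : Set α | N.IsCircuit C ∧ C.ncard = 2}.ncard * (N.E.ncard - 2) := by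
    calc A.ncard ≤ ∑ C ∈ Matroid.circF N 2, {X : Set α | X ⊆ N.E ∧ X.ncard = 3 ∧ C ⊆ X}.ncard :=
          Finset.set_ncard_biUnion_le (Matroid.circF N 2) _
      _ ≤ ∑ _C ∈ Matroid.circF N 2, (N.E.ncard - 2) := by
          refine Finset.sum_le_sum (fun C hC => ?_)
          obtain ⟨hCc, hC2⟩ := Matroid.mem_circF.1 hC
          have h := ncard_subsets_superset_le N hCc.subset_ground 3
          rw [hC2] at h
          exact h.trans (by rw [Nat.choose_one_right])
      _ = {C : Set α | N.IsCircuit C ∧ C.ncard = 2}.ncard * (N.E.ncard - 2) := by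
          rw [Finset.sum_const, smul_eq_mul, Matroid.card_circF]
  have hc2 := Matroid.ncard_circuits_le_choose N hν 1
  have hc3 := Matroid.ncard_circuits_le_choose N hν 2
  norm_num at hc2 hc3
  have hu := Set.ncard_le_ncard hcover (hAfin.union h3fin)
  have hu1 := Set.ncard_union_le A {C : Set α | N.IsCircuit C ∧ C.ncard = 3}
  calc {X : Set α | X ⊆ N.E ∧ X.ncard = 3 ∧ N.Dep X}.ncard
      ≤ A.ncard + {C : Set α | N.IsCircuit C ∧ C.ncard = 3}.ncard := hu.trans hu1
    _ ≤ {C : Set α | N.IsCircuit C ∧ C.ncard = 2}.ncard * (N.E.ncard - 2) + (ν + 2).choose 3 := by gcongr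
    _ ≤ (ν + 1).choose 2 * (N.E.ncard - 2) + (ν + 2).choose 3 := by gcongr

/-- **No loops in `M ／ W` when `W` is a flat.** -/
theorem contract_not_isLoop_of_closure_eq (M : Matroid α) {W : Set α} (hWcl : M.closure W = W) :
    ∀ e ∈ (M ／ W).E, ¬ (M ／ W).IsLoop e := by
  intro e _ he
  rw [Matroid.contract_isLoop_iff_mem_closure, hWcl] at he
  exact he.2 he.1

end S2

end PercRepro
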